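import Summits.PneNP.PneNP.Theorems.KarlinRubinMonotoneSufficesCoverCircuit
import Summits.PneNP.PneNP.Theorems.KarlinRubinMonotoneSufficesCoverStars
import Summits.PneNP.PneNP.Theorems.KarlinRubinMonotoneSufficesCoverParams
import Summits.PneNP.PneNP.Theorems.KarlinRubinMonotoneSufficesRoomMain

/-!
# Crux `MonotoneSuffices` (stmt-PneNP-18026), the COVERING-DESIGN room theorem — part 5: assembly

**The covering-design room theorem** (`karlinRubin_exists_monotone_detector_cover`): for every
`δ ∈ (0,1/2)` and every `ε > 0` there is a family of MONOTONE circuits over `{∧₂, ∨₂, 0, 1}` on the edges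
of `Kₙ`, of size `≤ n^{(δ+2δ²+ε) log₂ n}` eventually, whose `G(n,1/2)`-acceptance probability plus
planted-`⌈n^{1/2-δ}⌉`-clique rejection probability tends to `0`.

It is the guess-and-verify detector of the room theorem (`karlinRubin_exists_monotone_detector_quasipoly`,
size `n^{(2δ+ε) log₂ n}`) run on a FIXED covering family of only
`m = (⌊log₂ n⌋+1)(⌊C(n,t)/C(k,t)⌋+1) ≈ ln n · (n/k)^t` of the `C(n,t)` `t`-sets (`2^t ≈ n^{2δ} log² n` as
before): the type-I error is a union bound over `m ≤ C(n,t)` sets (part 2), a uniformly random planted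
`k`-set contains SOME member of the family except with probability `≤ (1 - C(k,t)/C(n,t))^m ≤ e^{-(L+1)}`
for a family chosen by averaging (part 1, the probabilistic method; circuits are non-uniform), and on that
event the planted count of the room theorem applies verbatim (part 2). The exponent drops from
`2δ = log₂ C(n,t) / log₂² n` to `δ + 2δ² = (1/2+δ) · 2δ = log₂ (n/k)^t / log₂² n`, which is `< 2δ` for every
`δ < 1/2` — and which EQUALS the exponent of the best general (non-monotone) detector known for
`δ ≤ 1/6` (sample `(n/k)^t` random `t`-sets, verify each in polynomial time).

Consequence for the crux (`karlinRubin_monotoneSufficesAt_explicit_of_quasipolyHardAt`): a quasi-polynomial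
nonuniform lower bound `size ≥ n^{η log₂ n}` at `δ` for strongly detecting `B₂` families gives the
`MonotoneSuffices` instance at `δ` with the EXPLICIT exponent `a = ⌊(δ+2δ²)/η⌋ + 1` for every budget
(the existential form, `karlinRubin_monotoneSuffices_of_quasipolyHard_real`, had `⌈3δ/η⌉ + 1`).
-/

set_option linter.dupNamespace false -- `Summit.PneNP.PneNP.…`: summit = sub-problem name (D-0017 single-conjunct layout)

namespace Summit.PneNP.PneNP.Theorems.MonotoneSuffices.Cover

open Filter Topology Finset Real
open scoped ENNReal
open Literature.Computability.Complexity
open Literature.Probability.RandomGraphs.PlantedClique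
open Summit.PneNP.PneNP.Theorems.MonotoneSuffices.Room

/-! ### Small analytic and measure-theoretic helpers -/

/-- `c e^{-(⌊log₂ n⌋ + 1)} → 0` in `ℝ≥0∞`. [folklore] -/
theorem tendsto_ofReal_const_mul_exp_neg (c : ℝ) :
    Tendsto (fun n : ℕ => ENNReal.ofReal (c * Real.exp (-((Nat.log 2 n : ℝ) + 1)))) atTop (𝓝 0) := by
  have h0 : Tendsto (fun n : ℕ => Nat.log 2 n) atTop atTop :=
    tendsto_atTop_atTop.2 fun b => ⟨2 ^ b, fun n hn => Nat.le_log_of_pow_le (by norm_num) hn⟩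
  have h1 : Tendsto (fun n : ℕ => (Nat.log 2 n : ℝ) + 1) atTop atTop :=
    tendsto_atTop_add_const_right _ 1 (tendsto_natCast_atTop_atTop.comp h0)
  have h2 : Tendsto (fun n : ℕ => c * Real.exp (-((Nat.log 2 n : ℝ) + 1))) atTop (𝓝 0) := by
    simpa using (Real.tendsto_exp_neg_atTop_nhds_zero.comp h1).const_mul c
  rw [← ENNReal.ofReal_zero]
  exact ENNReal.tendsto_ofReal h2

/-- A ratio bound `a ≤ b e` of naturals is the bound `a / b ≤ e` in `ℝ≥0∞`. [folklore] -/
theorem natCast_div_le_ofReal {a b : ℕ} {e : ℝ} (hb : 0 < b) (he : 0 ≤ e) (h : (a : ℝ) ≤ b * e) :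
    (a : ℝ≥0∞) / (b : ℝ≥0∞) ≤ ENNReal.ofReal e := by
  have hb0 : (b : ℝ≥0∞) ≠ 0 := by exact_mod_cast hb.ne'
  have hbtop : (b : ℝ≥0∞) ≠ ⊤ := ENNReal.natCast_ne_top _
  rw [ENNReal.div_le_iff hb0 hbtop]
  calc (a : ℝ≥0∞) = ENNReal.ofReal (a : ℝ) := by rw [ENNReal.ofReal_natCast]
    _ ≤ ENNReal.ofReal (e * b) := ENNReal.ofReal_le_ofReal (by linarith)
    _ = ENNReal.ofReal e * (b : ℝ≥0∞) := by rw [ENNReal.ofReal_mul he, ENNReal.ofReal_natCast]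

/-- **Averaging over the planted set with an exceptional family.** If `Pr_z[plant A z ∈ S] ≤ e` for every
planted set `A` of the right size outside an exceptional family `B`, then
`Pr_{G(n,1/2,k)}[S] ≤ e + #B / #kSubsets`. [folklore] -/
theorem plantedCliqueDist_le_of_forall_off {n k : ℕ} (S : Set (EdgeVec n)) (e : ℝ≥0∞)
    (B : Finset (Finset (Fin n)))
    (h : ∀ A ∈ kSubsets n k, A ∉ B → (erdosRenyiHalf n).toOuterMeasure {x | plant A x ∈ S} ≤ e) :
    (plantedCliqueDist n k).toOuterMeasure S ≤ e + (#B : ℝ≥0∞) / ((#(kSubsets n k) : ℕ) : ℝ≥0∞) := by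
  classical
  rw [plantedCliqueDist_toOuterMeasure_eq_sum]
  have hc0 : ((#(kSubsets n k) : ℕ) : ℝ≥0∞) ≠ 0 := by
    exact_mod_cast (card_pos.2 (kSubsets_nonempty n k)).ne'
  have hctop : ((#(kSubsets n k) : ℕ) : ℝ≥0∞) ≠ ⊤ := ENNReal.natCast_ne_top _
  -- termwise: `μ_A ≤ e + [A ∈ B]`
  have hterm : ∀ A ∈ kSubsets n k, (erdosRenyiHalf n).toOuterMeasure {x | plant A x ∈ S} ≤
      e + (if A ∈ B then 1 else 0) := by
    intro A hA
    by_cases hB : A ∈ B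
    · rw [if_pos hB]
      calc (erdosRenyiHalf n).toOuterMeasure {x | plant A x ∈ S}
          ≤ (erdosRenyiHalf n).toOuterMeasure Set.univ :=
            (erdosRenyiHalf n).toOuterMeasure.mono (Set.subset_univ _)
        _ = 1 := (PMF.toOuterMeasure_apply_eq_one_iff _ _).2 (Set.subset_univ _)
        _ ≤ e + 1 := le_add_self
    · rw [if_neg hB, add_zero]
      exact h A hA hB
  have hsumB : ∑ A ∈ kSubsets n k, (if A ∈ B then (1 : ℝ≥0∞) else 0) ≤ (#B : ℝ≥0∞) := by
    rw [sum_boole]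
    exact_mod_cast card_le_card fun A hA => (mem_filter.1 hA).2
  calc ((#(kSubsets n k) : ℕ) : ℝ≥0∞)⁻¹ * ∑ A ∈ kSubsets n k, (erdosRenyiHalf n).toOuterMeasure {x | plant A x ∈ S}
      ≤ ((#(kSubsets n k) : ℕ) : ℝ≥0∞)⁻¹ * (((#(kSubsets n k) : ℕ) : ℝ≥0∞) * e + #B) := by
        gcongr
        calc ∑ A ∈ kSubsets n k, (erdosRenyiHalf n).toOuterMeasure {x | plant A x ∈ S}
            ≤ ∑ A ∈ kSubsets n k, (e + (if A ∈ B then 1 else 0)) := sum_le_sum hterm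
          _ = ((#(kSubsets n k) : ℕ) : ℝ≥0∞) * e + ∑ A ∈ kSubsets n k, (if A ∈ B then (1 : ℝ≥0∞) else 0) := by
              rw [sum_add_distrib, sum_const, nsmul_eq_mul]
          _ ≤ ((#(kSubsets n k) : ℕ) : ℝ≥0∞) * e + #B := add_le_add le_rfl hsumB
    _ = e + (#B : ℝ≥0∞) / ((#(kSubsets n k) : ℕ) : ℝ≥0∞) := by
        rw [mul_add, ← mul_assoc, ENNReal.inv_mul_cancel hc0 hctop, one_mul, ENNReal.div_eq_inv_mul]

/-! ### The covering family and the per-`n` step -/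

/-- The `t`-subsets of the vertex set contained in `S` are the `t`-subsets of `S`. [folklore] -/
theorem filter_powersetCard_subset {n t : ℕ} (S : Finset (Fin n)) :
    (powersetCard t (univ : Finset (Fin n))).filter (fun T => T ⊆ S) = powersetCard t S := by
  ext T
  simp only [mem_filter, mem_powersetCard, subset_univ, true_and]
  exact ⟨fun h => ⟨h.2, h.1⟩, fun h => ⟨h.2, h.1⟩⟩

/-- **A good covering family exists** (for `t ≤ n`): `m` `t`-sets of vertices such that the planted
`k`-sets containing none of them number at most `C(n,k) · exp(-C(k,t) m / C(n,t))`. [folklore] -/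
theorem exists_cover_family (n t k m : ℕ) (htn : t ≤ n) :
    ∃ T : Fin m → Finset (Fin n), (∀ i, #(T i) = t) ∧
      (#((powersetCard k (univ : Finset (Fin n))).filter fun S => ∀ i, ¬ T i ⊆ S) : ℝ) ≤
        (n.choose k : ℝ) * Real.exp (-(((k.choose t : ℕ) : ℝ) * m / (n.choose t : ℕ))) := by
  classical
  have hU : (powersetCard t (univ : Finset (Fin n))).Nonempty :=
    powersetCard_nonempty.2 (by rw [card_univ, Fintype.card_fin]; exact htn)
  have hP : ∀ S ∈ powersetCard k (univ : Finset (Fin n)),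
      k.choose t ≤ #((powersetCard t (univ : Finset (Fin n))).filter fun T => T ⊆ S) := by
    intro S hS
    rw [filter_powersetCard_subset, card_powersetCard, (mem_powersetCard.1 hS).2]
  obtain ⟨f, hf, hmiss⟩ := exists_family_few_misses_real (powersetCard t (univ : Finset (Fin n)))
    (powersetCard k (univ : Finset (Fin n))) (fun T S => T ⊆ S) (k.choose t) m hU hP
  refine ⟨f, fun i => (mem_powersetCard.1 (Fintype.mem_piFinset.1 hf i)).2, ?_⟩
  simp only [card_powersetCard, card_univ, Fintype.card_fin] at hmiss
  exact hmiss

/-- **The per-`n` step of the covering-design detector**: a monotone circuit of size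
`≤ m (n(t+1) + 60(n+3)^4 + 1)` computing `[∃ i, θ ≤ cnt_{T i} x]` for a good covering family `T`.
[folklore] -/
theorem cover_step (n t θ k m : ℕ) (htn : t ≤ n) (hm : 0 < m) :
    ∃ C : Circuit ((⊤ : SimpleGraph (Fin n)).edgeSet), C.IsOver monotoneBasis01 ∧
      C.size ≤ m * (n * (t + 1) + 60 * (n + 3) ^ 4 + 1) ∧
      ∃ T : Fin m → Finset (Fin n), (∀ i, #(T i) = t) ∧
        (#((powersetCard k (univ : Finset (Fin n))).filter fun S => ∀ i, ¬ T i ⊆ S) : ℝ) ≤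
          (n.choose k : ℝ) * Real.exp (-(((k.choose t : ℕ) : ℝ) * m / (n.choose t : ℕ))) ∧
        ∀ x, C.eval x = decide (∃ i : Fin m,
          θ ≤ #((univ \ T i).filter fun u => ∀ e ∈ (univ.filter fun e : (⊤ : SimpleGraph (Fin n)).edgeSet =>
            ∃ w ∈ T i, (e : Sym2 (Fin n)) = s(u, w)), x e = true)) := by
  obtain ⟨T, hT, hmiss⟩ := exists_cover_family n t k m htn
  obtain ⟨C, hCB, hCs, hCe⟩ := exists_family_detector_circuit n t θ m hm T hT
  exact ⟨C, hCB, hCs, T, hT, hmiss, hCe⟩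

end Summit.PneNP.PneNP.Theorems.MonotoneSuffices.Cover

namespace Summit.PneNP.PneNP.Theorems

open Filter Topology Finset Real
open scoped ENNReal
open Literature.Computability.Complexity
open Literature.Probability.RandomGraphs.PlantedClique
open Summit.PneNP.PneNP.Theorems.MonotoneSuffices.Room
open Summit.PneNP.PneNP.Theorems.MonotoneSuffices.Cover

/-! ### The covering-design room theorem -/

/-- **The covering-design room theorem: a MONOTONE strong detector of size `n^{(δ+2δ²+ε) log₂ n}` for planted
cliques below `√n`.** For every `δ ∈ (0,1/2)` and `ε > 0` there is a family of circuits over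
`{∧₂, ∨₂, 0, 1}` on the edges of `Kₙ` with `size ≤ n^{(δ+2δ²+ε) log₂ n}` eventually whose
`G(n,1/2)`-acceptance probability plus planted-`⌈n^{1/2-δ}⌉`-clique rejection probability tends to `0`
(guess from a fixed covering family of `≈ ln n · (n/k)^t` `t`-sets, `t ≈ 2δ log₂ n + 2 log₂ log₂ n`, verify by
counting common neighbours). [folklore] -/
theorem karlinRubin_exists_monotone_detector_cover (δ ε : ℝ) (hδ : 0 < δ) (hδ' : δ < 1 / 2) (hε : 0 < ε) :
    ∃ C : (n : ℕ) → Circuit ((⊤ : SimpleGraph (Fin n)).edgeSet),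
      (∀ n, (C n).IsOver monotoneBasis01) ∧
      (∀ᶠ n : ℕ in atTop, ((C n).size : ℝ) ≤ (n : ℝ) ^ ((δ + 2 * δ ^ 2 + ε) * Real.logb 2 n)) ∧
      Tendsto (fun n : ℕ => (erdosRenyiHalf n).toOuterMeasure {x | (C n).eval x = true} +
        (plantedCliqueDist n ⌈(n : ℝ) ^ (1 / 2 - δ)⌉₊).toOuterMeasure {x | (C n).eval x = false})
        atTop (𝓝 0) := by
  classical
  -- the parameters
  let k : ℕ → ℕ := fun n => ⌈(n : ℝ) ^ (1 / 2 - δ)⌉₊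
  let L : ℕ → ℕ := fun n => Nat.log 2 n
  let Q : ℕ → ℕ := fun n => 800 * n * (L n + 1) ^ 2 / k n ^ 2 + 1
  let t : ℕ → ℕ := fun n => Nat.log 2 (Q n) + 1
  let θ : ℕ → ℕ := fun n => (n - t n) / 2 ^ t n + k n / 4 + 1
  let m : ℕ → ℕ := fun n => (L n + 1) * (n.choose (t n) / (k n).choose (t n) + 1)
  have hmpos : ∀ n, 0 < m n := fun n => Nat.mul_pos (Nat.succ_pos _) (Nat.succ_pos _)
  -- the family: the covering detector where `t n ≤ n`, a constant otherwise
  have hconst : ∀ n : ℕ, ∃ C : Circuit ((⊤ : SimpleGraph (Fin n)).edgeSet), C.IsOver monotoneBasis01 ∧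
      C.size ≤ 1 ∧ ∀ x, C.eval x = false := fun n => (cktSize_const_mono01 _ false).toCircuit
  let C : (n : ℕ) → Circuit ((⊤ : SimpleGraph (Fin n)).edgeSet) := fun n =>
    if h : t n ≤ n then (cover_step n (t n) (θ n) (k n) (m n) h (hmpos n)).choose else (hconst n).choose
  have hCover : ∀ n, (C n).IsOver monotoneBasis01 := by
    intro n
    by_cases h : t n ≤ n
    · simp only [C, dif_pos h]; exact (cover_step n (t n) (θ n) (k n) (m n) h (hmpos n)).choose_spec.1
    · simp only [C, dif_neg h]; exact (hconst n).choose_spec.1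
  have hε2 : 0 < ε / 2 := by linarith
  refine ⟨C, hCover, ?_, ?_⟩
  · -- size
    filter_upwards [eventually_base hδ hδ' hε2] with n ⟨hn, hkBig, h6k, hk2, hkSq, hslack⟩
    obtain ⟨⟨-, -, htn⟩, -, -, -⟩ :=
      room_derived (δ := δ) (ε := ε / 2) (n := n) (k := k n) (L := L n) (Q := Q n) (t := t n) (θ := θ n)
        rfl rfl rfl rfl hn hkBig h6k hk2 hkSq hslack
    obtain ⟨-, -, -, hsize⟩ :=
      cover_derived (δ := δ) (ε := ε) (n := n) (k := k n) (L := L n) (Q := Q n) (t := t n)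
        hδ hδ' rfl rfl rfl hn hkBig h6k hk2 hkSq (rpow_le_k δ n) hslack
    simp only [C, dif_pos htn]
    refine le_trans ?_ hsize
    exact_mod_cast (cover_step n (t n) (θ n) (k n) (m n) htn (hmpos n)).choose_spec.2.1
  · -- errors
    refine tendsto_of_tendsto_of_tendsto_of_le_of_le' tendsto_const_nhds (tendsto_ofReal_const_mul_exp_neg 3)
      (Eventually.of_forall fun n => bot_le) ?_
    filter_upwards [eventually_base hδ hδ' hε2] with n ⟨hn, hkBig, h6k, hk2, hkSq, hslack⟩
    obtain ⟨⟨-, hkn, htn⟩, ⟨hμ0, hμθ, hθμ, hnull⟩, ⟨hμ₁0, hτlo, hτhi, hplanted⟩, -⟩ :=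
      room_derived (δ := δ) (ε := ε / 2) (n := n) (k := k n) (L := L n) (Q := Q n) (t := t n) (θ := θ n)
        rfl rfl rfl rfl hn hkBig h6k hk2 hkSq hslack
    obtain ⟨-, hmC, hLm, -⟩ :=
      cover_derived (δ := δ) (ε := ε) (n := n) (k := k n) (L := L n) (Q := Q n) (t := t n)
        hδ hδ' rfl rfl rfl hn hkBig h6k hk2 hkSq (rpow_le_k δ n) hslack
    have hCn : C n = (cover_step n (t n) (θ n) (k n) (m n) htn (hmpos n)).choose := by
      simp only [C, dif_pos htn]
    obtain ⟨T, hT, hmiss, hDe⟩ := (cover_step n (t n) (θ n) (k n) (m n) htn (hmpos n)).choose_spec.2.2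
    rw [← hCn] at hDe
    set e : ℝ := Real.exp (-((L n : ℝ) + 1)) with he
    have he0 : 0 ≤ e := (Real.exp_pos _).le
    -- type I: union bound over the `m ≤ C(n,t)` members
    have hI : (erdosRenyiHalf n).toOuterMeasure {x | (C n).eval x = true} ≤ ENNReal.ofReal e := by
      refine erdosRenyiHalf_le_ofReal _ he0 ?_
      set μ : ℝ := ((n - t n : ℕ) : ℝ) * (2 : ℝ)⁻¹ ^ t n with hμ
      have hη0 : 0 ≤ (θ n : ℝ) / μ - 1 := by rw [sub_nonneg, le_div_iff₀ hμ0]; linarith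
      have hη2 : (θ n : ℝ) / μ - 1 ≤ 2 := by rw [sub_le_iff_le_add, div_le_iff₀ hμ0]; linarith
      have hθeq : (1 + ((θ n : ℝ) / μ - 1)) * μ ≤ θ n := by
        rw [add_sub_cancel, div_mul_cancel₀ _ hμ0.ne']
      have hcount := card_null_family_le T (t n) (θ n) hT hη0 hη2 hθeq
      rw [← hμ] at hcount
      have hset : (univ.filter fun x : EdgeVec n => x ∈ {x | (C n).eval x = true}) =
          univ.filter fun x : EdgeVec n => ∃ i : Fin (m n),
            θ n ≤ #((univ \ T i).filter fun u => ∀ e ∈ (univ.filter fun e : (⊤ : SimpleGraph (Fin n)).edgeSet =>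
              ∃ w ∈ T i, (e : Sym2 (Fin n)) = s(u, w)), x e = true) := by
        ext x
        simp only [mem_filter, mem_univ, true_and, Set.mem_setOf_eq, hDe, decide_eq_true_eq]
      rw [hset]
      refine hcount.trans ?_
      have hmC' : ((m n : ℕ) : ℝ) ≤ (n.choose (t n) : ℝ) := by exact_mod_cast hmC
      rw [neg_div] at hnull
      calc ((m n : ℕ) : ℝ) * (2 ^ Fintype.card (⊤ : SimpleGraph (Fin n)).edgeSet *
            Real.exp (-(((θ n : ℝ) / μ - 1) ^ 2 * μ / 4)))
          ≤ (n.choose (t n) : ℝ) * (2 ^ Fintype.card (⊤ : SimpleGraph (Fin n)).edgeSet *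
            Real.exp (-(((θ n : ℝ) / μ - 1) ^ 2 * μ / 4))) := mul_le_mul_of_nonneg_right hmC' (by positivity)
        _ = 2 ^ Fintype.card (⊤ : SimpleGraph (Fin n)).edgeSet * ((n.choose (t n) : ℝ) *
            Real.exp (-(((θ n : ℝ) / μ - 1) ^ 2 * μ / 4))) := by ring
        _ ≤ 2 ^ Fintype.card (⊤ : SimpleGraph (Fin n)).edgeSet * e :=
            mul_le_mul_of_nonneg_left hnull (by positivity)
    -- type II: good planted sets (containing a member) by the planted count, bad ones by the averaging
    set B : Finset (Finset (Fin n)) := (kSubsets n (k n)).filter fun A => ∀ i, ¬ T i ⊆ A with hB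
    have hgood : ∀ A ∈ kSubsets n (k n), A ∉ B →
        (erdosRenyiHalf n).toOuterMeasure {z | plant A z ∈ {x | (C n).eval x = false}} ≤ ENNReal.ofReal e := by
      intro A hA hAB
      have hex : ∃ i, T i ⊆ A := by
        by_contra hne
        push Not at hne
        exact hAB (mem_filter.2 ⟨hA, hne⟩)
      obtain ⟨i₀, hi₀⟩ := hex
      have hAcard : #A = k n := by rw [card_of_mem_kSubsets hA]; exact min_eq_left hkn
      refine erdosRenyiHalf_le_ofReal _ he0 ?_
      set μ₁ : ℝ := ((n - k n : ℕ) : ℝ) * (2 : ℝ)⁻¹ ^ t n with hμ₁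
      set τ : ℝ := (θ n : ℝ) - ((k n - t n : ℕ) : ℝ) - 1 with hτ
      have hη0 : 0 ≤ 1 - τ / μ₁ := by rw [sub_nonneg, div_le_one hμ₁0]; exact hτhi
      have hη2 : 1 - τ / μ₁ ≤ 2 := by
        have : -1 ≤ τ / μ₁ := by rw [le_div_iff₀ hμ₁0]; linarith
        linarith
      have hθeq : (θ n : ℝ) - ((#A - t n : ℕ) : ℝ) - 1 ≤
          (1 - (1 - τ / μ₁)) * (((n - #A : ℕ) : ℝ) * (2 : ℝ)⁻¹ ^ t n) := by
        rw [hAcard, sub_sub_cancel, div_mul_cancel₀ _ hμ₁0.ne']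
      have hcount := card_planted_family_le T A i₀ hi₀ (t n) (θ n) hT hη0 hη2 hθeq
      rw [hAcard, ← hμ₁] at hcount
      have hset : (univ.filter fun z : EdgeVec n => z ∈ {z | plant A z ∈ {x | (C n).eval x = false}}) =
          univ.filter fun z : EdgeVec n => ¬ ∃ i : Fin (m n),
            θ n ≤ #((univ \ T i).filter fun u => ∀ e ∈ (univ.filter fun e : (⊤ : SimpleGraph (Fin n)).edgeSet =>
              ∃ w ∈ T i, (e : Sym2 (Fin n)) = s(u, w)), plant A z e = true) := by
        ext z
        simp only [mem_filter, mem_univ, true_and, Set.mem_setOf_eq, hDe, decide_eq_false_iff_not]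
      rw [hset]
      refine hcount.trans ?_
      rw [neg_div] at hplanted
      exact mul_le_mul_of_nonneg_left hplanted (by positivity)
    have hbad : (#B : ℝ≥0∞) / ((#(kSubsets n (k n)) : ℕ) : ℝ≥0∞) ≤ ENNReal.ofReal e := by
      have hK : kSubsets n (k n) = powersetCard (k n) (univ : Finset (Fin n)) := by
        rw [kSubsets, min_eq_left hkn]
      have hKcard : #(kSubsets n (k n)) = n.choose (k n) := by
        rw [hK, card_powersetCard, card_univ, Fintype.card_fin]
      have hKpos : 0 < #(kSubsets n (k n)) := card_pos.2 (kSubsets_nonempty n (k n))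
      refine natCast_div_le_ofReal hKpos he0 ?_
      rw [hKcard]
      have hB' : (#B : ℝ) ≤ (n.choose (k n) : ℝ) *
          Real.exp (-((((k n).choose (t n) : ℕ) : ℝ) * (m n) / (n.choose (t n) : ℕ))) := by
        rw [hB, hK]; exact hmiss
      refine hB'.trans (mul_le_mul_of_nonneg_left (Real.exp_le_exp.2 ?_) (Nat.cast_nonneg _))
      have hCpos : (0 : ℝ) < ((n.choose (t n) : ℕ) : ℝ) := by exact_mod_cast Nat.choose_pos htn
      have hLm' : (((L n + 1) * n.choose (t n) : ℕ) : ℝ) ≤ ((m n * (k n).choose (t n) : ℕ) : ℝ) := by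
        exact_mod_cast hLm
      push_cast at hLm'
      rw [neg_le_neg_iff, le_div_iff₀ hCpos]
      linarith
    have hII : (plantedCliqueDist n (k n)).toOuterMeasure {x | (C n).eval x = false} ≤
        ENNReal.ofReal e + ENNReal.ofReal e :=
      (plantedCliqueDist_le_of_forall_off _ _ B hgood).trans (add_le_add le_rfl hbad)
    calc (erdosRenyiHalf n).toOuterMeasure {x | (C n).eval x = true} +
          (plantedCliqueDist n (k n)).toOuterMeasure {x | (C n).eval x = false}
        ≤ ENNReal.ofReal e + (ENNReal.ofReal e + ENNReal.ofReal e) := add_le_add hI hII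
      _ = ENNReal.ofReal (3 * e) := by
          rw [← ENNReal.ofReal_add he0 he0, ← ENNReal.ofReal_add he0 (by positivity)]
          congr 1; ring

/-! ### Consequence for `MonotoneSuffices`: the exponent delivered by a quasi-polynomial general lower bound -/

/-- **`MonotoneSuffices` at `δ` with the explicit exponent `a = ⌊(δ+2δ²)/η⌋ + 1` from a quasi-polynomial
planted-clique lower bound `n^{η log₂ n}` at `δ`.** If every strongly detecting `B₂` family at clique size
`⌈n^{1/2-δ}⌉` has size `≥ n^{η log₂ n}` eventually, then for EVERY budget `s`: a strongly detecting `B₂` family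
of size `≤ s(n)` yields a strongly detecting `{∧₂,∨₂,0,1}` family of size `≤ (s(n)+n)^a`, `a = ⌊(δ+2δ²)/η⌋+1`
— the budget is then `≥ n^{η log₂ n}` and the covering-design detector of size `n^{(δ+2δ²+ε) log₂ n}`,
`ε = aη - (δ+2δ²) > 0`, fits under `(s(n)+n)^a`. (The existential-`a` form is
`karlinRubin_monotoneSuffices_of_quasipolyHard_real`, which this sharpens from `a = ⌈3δ/η⌉+1`.) [folklore] -/
theorem karlinRubin_monotoneSufficesAt_explicit_of_quasipolyHardAt (δ η : ℝ) (hδ : 0 < δ) (hδ' : δ < 1 / 2)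
    (hη : 0 < η)
    (H : ∀ C : (n : ℕ) → Circuit ((⊤ : SimpleGraph (Fin n)).edgeSet),
        (∀ᶠ n : ℕ in atTop, (C n).IsOver B2) →
        Tendsto (fun n : ℕ =>
          (erdosRenyiHalf n).toOuterMeasure {x | (C n).eval x = true} +
            (plantedCliqueDist n ⌈(n : ℝ) ^ (1 / 2 - δ)⌉₊).toOuterMeasure {x | (C n).eval x = false})
          atTop (𝓝 0) →
        ∀ᶠ n : ℕ in atTop, (n : ℝ) ^ (η * Real.logb 2 n) ≤ (C n).size)
    (s : ℕ → ℕ)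
    (hs : ∃ C : (n : ℕ) → Circuit ((⊤ : SimpleGraph (Fin n)).edgeSet),
      (∀ᶠ n : ℕ in atTop, (C n).IsOver B2 ∧ (C n).size ≤ s n) ∧
      Tendsto (fun n : ℕ =>
        (erdosRenyiHalf n).toOuterMeasure {x | (C n).eval x = true} +
          (plantedCliqueDist n ⌈(n : ℝ) ^ (1 / 2 - δ)⌉₊).toOuterMeasure {x | (C n).eval x = false})
        atTop (𝓝 0)) :
    ∃ C' : (n : ℕ) → Circuit ((⊤ : SimpleGraph (Fin n)).edgeSet),
      (∀ᶠ n : ℕ in atTop, (C' n).IsOver monotoneBasis01 ∧ (C' n).size ≤ (s n + n) ^ (⌊(δ + 2 * δ ^ 2) / η⌋₊ + 1)) ∧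
      Tendsto (fun n : ℕ =>
        (erdosRenyiHalf n).toOuterMeasure {x | (C' n).eval x = true} +
          (plantedCliqueDist n ⌈(n : ℝ) ^ (1 / 2 - δ)⌉₊).toOuterMeasure {x | (C' n).eval x = false})
        atTop (𝓝 0) := by
  obtain ⟨C, hC, hT⟩ := hs
  set a : ℕ := ⌊(δ + 2 * δ ^ 2) / η⌋₊ + 1 with ha
  have haη : δ + 2 * δ ^ 2 < a * η := by
    have h1 : (δ + 2 * δ ^ 2) / η < (⌊(δ + 2 * δ ^ 2) / η⌋₊ : ℝ) + 1 := Nat.lt_floor_add_one _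
    have h2 : (a : ℝ) = (⌊(δ + 2 * δ ^ 2) / η⌋₊ : ℝ) + 1 := by rw [ha]; push_cast; ring
    rw [div_lt_iff₀ hη] at h1
    rw [h2]; linarith
  obtain ⟨C', hB', hC', hT'⟩ :=
    karlinRubin_exists_monotone_detector_cover δ (a * η - (δ + 2 * δ ^ 2)) hδ hδ' (by linarith)
  refine ⟨C', ?_, hT'⟩
  have hhard := H C (hC.mono fun n h => h.1) hT
  filter_upwards [hC', hC, hhard, eventually_ge_atTop 2] with n hn hCn hh h2
  refine ⟨hB' n, ?_⟩
  have hn1 : (1 : ℝ) ≤ n := by exact_mod_cast (show 1 ≤ n by omega)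
  -- `size C' ≤ n^{a η log₂ n} = (n^{η log₂ n})^a ≤ (s n)^a ≤ (s n + n)^a`
  have hs : (n : ℝ) ^ (η * Real.logb 2 n) ≤ s n := hh.trans (by exact_mod_cast hCn.2)
  have hreal : ((C' n).size : ℝ) ≤ ((s n + n) ^ a : ℕ) := by
    calc ((C' n).size : ℝ) ≤ (n : ℝ) ^ ((δ + 2 * δ ^ 2 + (a * η - (δ + 2 * δ ^ 2))) * Real.logb 2 n) := hn
      _ = (n : ℝ) ^ ((a : ℝ) * (η * Real.logb 2 n)) := by congr 1; ring
      _ = ((n : ℝ) ^ (η * Real.logb 2 n)) ^ a := by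
          rw [mul_comm (a : ℝ), Real.rpow_mul_natCast (by positivity)]
      _ ≤ (s n : ℝ) ^ a := pow_le_pow_left₀ (by positivity) hs a
      _ ≤ ((s n + n : ℕ) : ℝ) ^ a := pow_le_pow_left₀ (by positivity) (by push_cast; linarith) a
      _ = ((s n + n) ^ a : ℕ) := by push_cast; ring
  exact_mod_cast hreal

end Summit.PneNP.PneNP.Theorems

namespace Summit.PneNP.PneNP.Theorems

open Finset

/-- Registered sub-goal `cover_main` of stmt-PneNP-18026 (covering-design room theorem, part 5): **the covering-design
room theorem** (monotone strong detector of size `n^{(δ+2δ²+ε) log₂ n}`), exported verbatim. [folklore] -/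
theorem cover_main :
    ∀ (δ ε : ℝ), 0 < δ → δ < 1 / 2 → 0 < ε → ∃ C : (n : ℕ) → Literature.Computability.Complexity.Circuit ((⊤ : SimpleGraph (Fin n)).edgeSet), (∀ n, (C n).IsOver Literature.Computability.Complexity.monotoneBasis01) ∧ (∀ᶠ n : ℕ in Filter.atTop, ((C n).size : ℝ) ≤ (n : ℝ) ^ ((δ + 2 * δ ^ 2 + ε) * Real.logb 2 n)) ∧ Filter.Tendsto (fun n : ℕ => (Literature.Probability.RandomGraphs.PlantedClique.erdosRenyiHalf n).toOuterMeasure {x | (C n).eval x = true} + (Literature.Probability.RandomGraphs.PlantedClique.plantedCliqueDist n ⌈(n : ℝ) ^ (1 / 2 - δ)⌉₊).toOuterMeasure {x | (C n).eval x = false}) Filter.atTop (nhds 0) :=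
  fun δ ε hδ hδ' hε => karlinRubin_exists_monotone_detector_cover δ ε hδ hδ' hε

end Summit.PneNP.PneNP.Theorems
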